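import Literature.Computability.Complexity.ClockedUniversalAcceptance
import Literature.Computability.Complexity.UniversalStepBounds
import Literature.Computability.Complexity.TM2StdNormal
import Literature.Computability.Complexity.SearchToDecision
import HarnessLib

/-!
# Clocked universal acceptance testing in polynomial time — the discharge

Proof of the named fact `clockedUniversalAcceptance` (`ClockedUniversalAcceptance.lean`;
Arora–Barak 2009, Thm. 1.9 with §1.4.1 "Universal TM with time bound": a universal machine with
a step counter decides `{⟨e, ⟨w, 1ᴺ⟩⟩ | M_e accepts w within the budget N}` in polynomial time) for
Mathlib's multi-stack machines `Turing.TM2ComputableAux Bool Bool`, assembled from the tree's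
universal-machine pipeline:

1. `M` ↦ its halting guard (`HaltGuard.lean`) ↦ the standard machine (`PolyTimeCountable.lean`)
   ↦ alphabet recoded so that the input symbols are `0`/`1` (`TM2StdNormal.lean`,
   `FlatProg.pcode M π`) ↦ the flat program `P = FlatProg.compile (pcode M π)`
   (`FlatPrograms.lean`), with the two-way interface `FlatProg.pflat_complete` /
   `FlatProg.pflat_sound` (`FlatRuns.lean`, `TM2StdNormal.lean`);
2. the universal step `UnivStep.ustepFn ∈ FP` on string codes `⟨P, ⟨pc, stacks⟩⟩`
   (`UniversalStep.lean`), its growth bound and the string form of initial configurations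
   (`UniversalStepBounds.lean`);
3. clocked iteration of a first-component-keeping `FP` function (`iterate_mem_FP_of_growth`,
   `IterateFPGrowth.lean`) and "languages with an `FP` indicator are in `P`"
   (`mem_P_of_mem_FP`, `LengthCompare.lean`).

The decider (`ClockedUA.verdict`): an instance is `inst = ⟨e, ⟨w, u⟩⟩` with
`e = ⟨program, ⟨initial pc, ⟨prefix, ⟨suffix, target stacks⟩⟩⟩⟩`; it writes the initial code
`z₀ = ⟨program, ⟨pc, prefix ++ h(w) ++ suffix⟩⟩` (`ClockedUA.ι`; `h = UnivStep.encInput`, one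
finite-state substitution, `ClockedUA.encInput_mem_FP`), runs `|inst|` rounds of the GUARDED
universal step `ClockedUA.F : ⟨inst, z⟩ ↦ ⟨inst, ustepFn z⟩` (the step is taken only if it
lengthens the state by at most `4` symbols beyond `|⟨inst, z⟩|`, which honest codes always
satisfy, `UnivStep.length_enc_step_le` — the guard makes the growth bound hold on EVERY input,
as `iterate_mem_FP_of_growth` demands), and accepts iff the final code is halted (empty
fetched-instruction field) with stacks field equal to the target (`ClockedUA.checkF`). The
language `ClockedUA.U` of accepted instances is in `P` (`ClockedUA.U_mem_P`); for a machine `M`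
the code `ClockedUA.code M` carries the flat program of `pcode M π`, its initial program counter,
the codes of the empty stacks around the input stack and the coded halting stacks with output
`[true]`, and the overhead polynomial is `haltAddr · X` (`ClockedUA.complete`, `ClockedUA.sound`,
from `pflat_complete` / `pflat_sound` along the honest orbit `ClockedUA.orbit_inst`).

Main result: `clockedUniversalAcceptance_holds : clockedUniversalAcceptance`.

## References

* S. Arora, B. Barak, *Computational Complexity: A Modern Approach*, CUP 2009, Thm. 1.9 and
  §1.4.1 (book pp. 20–21: proof of the relaxed Thm. 1.9 — a table-driven interpreter, `C` steps
  of `𝒰` per step of `M` — and "Universal TM with time bound": "a variant of the universal TM `𝒰`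
  that gets a number `T` as an extra input …, and outputs `M_α(x)` if and only if `M_α` halts on
  `x` within `T` steps … by adding a time counter to `𝒰`"), Thm. 2.9 (`TMSAT`)
  [AroraBarakCC2009]. doi:10.1017/cbo9780511804090
-/

noncomputable section

namespace Literature.Computability.Complexity

open _root_.Computability Polynomial Brick Turing

namespace ClockedUA

open UnivStep FlatProg TM2Std

/-! ### The input substitution is polynomial-time -/

/-- The one-state transducer writing `UnivStep.encInput`. [folklore] -/
def inputFST : FST Unit Bool Bool where
  init := ()
  step := fun _ b => ((), inputHom b)
  front := fun _ => []
  keep := fun _ => true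

/-- The transducer emits `encInput`. [folklore] -/
theorem inputFST_run (w : List Bool) : inputFST.run () w = ((), encInput w) := by
  induction w with
  | nil => rfl
  | cons b w ih =>
    rw [FST.run_cons]
    show ((inputFST.run () w).1, inputHom b ++ (inputFST.run () w).2) = ((), encInput (b :: w))
    rw [ih]
    rfl

/-- The transducer computes `encInput`. [folklore] -/
theorem inputFST_eval : inputFST.eval = encInput := by
  funext w
  rw [FST.eval, show inputFST.init = () from rfl, inputFST_run]
  rfl

/-- **`encInput ∈ FP`.** [cite: AroraBarakCC2009, §1.3 (finite-state recodings are polynomial-time)] -/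
theorem encInput_mem_FP : encInput ∈ FP := by
  rw [← inputFST_eval]
  exact inputFST.polyTimeComputable_eval

/-- The identity is in `FP` (as `fun w => w`; cf. `OracleCompose.id_mem_FP` of
`CookReducibilityTransitive.lean`, not imported here). [folklore] -/
theorem id_mem_FP : (fun w : List Bool => w) ∈ FP := PolyTimeComputable.id _

/-! ### Instances `⟨e, ⟨w, u⟩⟩`, `e = ⟨program, ⟨pc, ⟨prefix, ⟨suffix, target⟩⟩⟩⟩`, and the initial code -/

/-- Instance field: the input word `w`. [folklore] -/
def wI : List Bool → List Bool := nthF 1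
/-- Code field: the program. [folklore] -/
def progI : List Bool → List Bool := nthF 0 ∘ nthF 0
/-- Code field: the initial program counter. [folklore] -/
def pcI : List Bool → List Bool := nthF 1 ∘ nthF 0
/-- Code field: the coded empty stacks before the input stack. [folklore] -/
def preI : List Bool → List Bool := nthF 2 ∘ nthF 0
/-- Code field: the coded empty stacks after the input stack. [folklore] -/
def sufI : List Bool → List Bool := nthF 3 ∘ nthF 0
/-- Code field: the target stacks field (coded halting stacks with output `[true]`). [folklore] -/
def tgtI : List Bool → List Bool := sndPow 3 ∘ nthF 0

/-- The stacks field of the initial code: `prefix ++ encInput w ++ suffix`.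
[cite: AroraBarakCC2009, §1.4 (writing the initial configuration of the simulated machine)] -/
def stkI : List Bool → List Bool :=
  appendFn ∘ fanoutFn preI (appendFn ∘ fanoutFn (encInput ∘ wI) sufI)

/-- **The initial code** `z₀ = ⟨program, ⟨pc, stacks⟩⟩` of an instance.
[cite: AroraBarakCC2009, §1.4.1] -/
def ι : List Bool → List Bool := fanoutFn progI (fanoutFn pcI stkI)

/-- `ι` on an instance. [folklore] -/
theorem ι_apply (prog pc pre suf tgt w u : List Bool) :
    ι (boolPair (boolPair prog (boolPair pc (boolPair pre (boolPair suf tgt)))) (boolPair w u)) =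
      boolPair prog (boolPair pc (pre ++ (encInput w ++ suf))) := by
  simp [ι, stkI, progI, pcI, preI, sufI, wI]

/-- `tgtI` on an instance. [folklore] -/
theorem tgtI_apply (prog pc pre suf tgt r : List Bool) :
    tgtI (boolPair (boolPair prog (boolPair pc (boolPair pre (boolPair suf tgt)))) r) = tgt := by
  simp [tgtI]

/-- `stkI ∈ FP`. [cite: AroraBarakCC2009, §1.3] -/
theorem stkI_mem_FP : stkI ∈ FP :=
  comp_mem_FP appendFn_mem_FP (fanoutFn_mem_FP (comp_mem_FP (nthF_mem_FP 2) (nthF_mem_FP 0))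
    (comp_mem_FP appendFn_mem_FP (fanoutFn_mem_FP (comp_mem_FP encInput_mem_FP (nthF_mem_FP 1))
      (comp_mem_FP (nthF_mem_FP 3) (nthF_mem_FP 0)))))

/-- `ι ∈ FP`. [cite: AroraBarakCC2009, §1.3] -/
theorem ι_mem_FP : ι ∈ FP :=
  fanoutFn_mem_FP (comp_mem_FP (nthF_mem_FP 0) (nthF_mem_FP 0))
    (fanoutFn_mem_FP (comp_mem_FP (nthF_mem_FP 1) (nthF_mem_FP 0)) stkI_mem_FP)

/-! ### The guarded universal step on states `⟨inst, z⟩` -/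

/-- The guard `[|ustepFn z| ≤ |⟨inst, z⟩| + 4]`. [folklore] -/
def guardC : List Bool → List Bool :=
  lenLeFn (X + 4) ∘ fanoutFn (fun w => w) (ustepFn ∘ sndF)

/-- **The guarded step** of the code: `ustepFn z` if the guard holds, `z` otherwise.
[cite: AroraBarakCC2009, §1.4.1 and Thm. 1.9] -/
def G : List Bool → List Bool := iteFn guardC (ustepFn ∘ sndF) sndF

/-- **One round**: `⟨inst, z⟩ ↦ ⟨inst, G ⟨inst, z⟩⟩`. [cite: AroraBarakCC2009, §1.4.1 and Thm. 1.9] -/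
def F : List Bool → List Bool := fanoutFn fstF G

/-- The guard bit. [folklore] -/
theorem guardC_apply (Z : List Bool) :
    guardC Z = [decide ((ustepFn (sndF Z)).length ≤ Z.length + 4)] := by
  simp [guardC, lenLeFn_boolPair]

/-- The guarded step, as an `if`. [folklore] -/
theorem G_apply (Z : List Bool) :
    G Z = if (ustepFn (sndF Z)).length ≤ Z.length + 4 then ustepFn (sndF Z) else sndF Z := by
  unfold G
  by_cases h : (ustepFn (sndF Z)).length ≤ Z.length + 4
  · rw [iteFn_apply_true (by rw [guardC_apply, decide_eq_true h]), if_pos h]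
    rfl
  · rw [iteFn_apply_false (by rw [guardC_apply, decide_eq_false h]), if_neg h]

/-- The guarded step lengthens the state by at most `4`. [folklore] -/
theorem length_G_le (Z : List Bool) : (G Z).length ≤ Z.length + 4 := by
  rw [G_apply]
  split_ifs with h
  · exact h
  · have := length_fstF_sndF_le Z
    omega

/-- One round, as a pair. [folklore] -/
theorem F_apply (Z : List Bool) : F Z = boolPair (fstF Z) (G Z) := fanoutFn_apply _ _ _

/-- **The round keeps the instance.** [folklore] -/
theorem fst_F (Z : List Bool) : (boolUnpair (F Z)).1 = (boolUnpair Z).1 := by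
  rw [F_apply, boolUnpair_boolPair]
  rfl

/-- **Growth of one round**: `|F Z| ≤ |Z| + 6 (|inst| + 1)` on EVERY input. [folklore] -/
theorem length_F_le (Z : List Bool) : (F Z).length ≤ Z.length + 6 * ((boolUnpair Z).1.length + 1) := by
  rw [F_apply, length_boolPair]
  have := length_G_le Z
  show _ ≤ _ + 6 * ((fstF Z).length + 1)
  omega

/-- `guardC ∈ FP`. [cite: AroraBarakCC2009, §1.3] -/
theorem guardC_mem_FP : guardC ∈ FP :=
  comp_mem_FP (lenLeFn_mem_FP _) (fanoutFn_mem_FP id_mem_FP (comp_mem_FP ustepFn_mem_FP sndF_mem_FP))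

/-- `G ∈ FP`. [cite: AroraBarakCC2009, §1.3] -/
theorem G_mem_FP : G ∈ FP :=
  iteFn_mem_FP guardC_mem_FP (comp_mem_FP ustepFn_mem_FP sndF_mem_FP) sndF_mem_FP

/-- `F ∈ FP`. [cite: AroraBarakCC2009, Thm. 1.9 (one simulated step is polynomial-time)] -/
theorem F_mem_FP : F ∈ FP := fanoutFn_mem_FP fstF_mem_FP G_mem_FP

/-! ### The clocked orbit and the verdict -/

/-- **The clocked orbit**: `|inst|` rounds of `F` from `⟨inst, ι inst⟩`.
[cite: AroraBarakCC2009, §1.4.1 (universal TM with time bound: a time counter)] -/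
def orbit : List Bool → List Bool :=
  (fun Z => F^[(X : Polynomial ℕ).eval (boolUnpair Z).1.length] Z) ∘ fanoutFn (fun w => w) ι

/-- The orbit of an instance. [folklore] -/
theorem orbit_apply (inst : List Bool) : orbit inst = F^[inst.length] (boolPair inst (ι inst)) := by
  simp [orbit]

/-- **The clocked orbit is polynomial-time** (`iterate_mem_FP_of_growth`). [cite: AroraBarakCC2009, Thm. 1.9 and §1.4.1] -/
theorem orbit_mem_FP : orbit ∈ FP :=
  comp_mem_FP (iterate_mem_FP_of_growth F_mem_FP 6 fst_F length_F_le X)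
    (fanoutFn_mem_FP id_mem_FP ι_mem_FP)

/-- The halting test on the final code: empty fetched-instruction field. [folklore] -/
def haltedC : List Bool → List Bool := isNilFn ∘ insF ∘ sndF
/-- The output test on the final code: stacks field = target. [folklore] -/
def stacksC : List Bool → List Bool := eqPairFn ∘ fanoutFn (ssF ∘ sndF) (tgtI ∘ fstF)
/-- The acceptance test. [cite: AroraBarakCC2009, §1.4.1 ("outputs M_α(x) iff M_α halts on x within T steps")] -/
def checkF : List Bool → List Bool := andFn haltedC stacksC
/-- **The verdict** of the clocked universal machine on an instance. [cite: AroraBarakCC2009, Thm. 1.9 and §1.4.1] -/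
def verdict : List Bool → List Bool := checkF ∘ orbit

/-- The acceptance test on a state. [folklore] -/
theorem checkF_boolPair (inst z : List Bool) :
    checkF (boolPair inst z) = [decide (insF z = []) && decide (ssF z = tgtI inst)] := by
  have h1 : haltedC (boolPair inst z) = [decide (insF z = [])] := by simp [haltedC, isNilFn]
  have h2 : stacksC (boolPair inst z) = [decide (ssF z = tgtI inst)] := by
    simp [stacksC, eqPairFn_boolPair]
  rw [checkF, andFn_apply h1 h2]

/-- The verdict is one bit. [folklore] -/
theorem verdict_eq_or (inst : List Bool) : verdict inst = [true] ∨ verdict inst = [false] := by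
  have hone : OneBit checkF :=
    oneBit_andFn (oneBit_isNilFn.comp _)
      (OneBit.comp (fun w => (eqPairFn_eq_or w).elim (fun h => ⟨true, h⟩) fun h => ⟨false, h⟩) _)
  obtain ⟨b, hb⟩ := hone (orbit inst)
  rw [verdict, Function.comp_apply, hb]
  cases b
  · exact Or.inr rfl
  · exact Or.inl rfl

/-- `verdict ∈ FP`. [cite: AroraBarakCC2009, Thm. 1.9 and §1.4.1] -/
theorem verdict_mem_FP : verdict ∈ FP :=
  comp_mem_FP
    (andFn_mem_FP (comp_mem_FP isNilFn_mem_FP (comp_mem_FP insF_mem_FP sndF_mem_FP))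
      (comp_mem_FP eqPairFn_mem_FP (fanoutFn_mem_FP (comp_mem_FP ssF_mem_FP sndF_mem_FP)
        (comp_mem_FP (comp_mem_FP (sndPow_mem_FP 3) (nthF_mem_FP 0)) fstF_mem_FP))))
    orbit_mem_FP

/-- **The bounded acceptance language `U`** of the clocked universal machine.
[cite: AroraBarakCC2009, §1.4.1 and Thm. 2.9 (TMSAT, deterministic core)] -/
def U : Language Bool := {inst | verdict inst = [true]}

/-- **`U ∈ P`.** [cite: AroraBarakCC2009, Thm. 1.9 and §1.4.1] -/
theorem U_mem_P : U ∈ Classes.P :=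
  mem_P_of_mem_FP verdict_mem_FP U fun w => ⟨fun h => h, fun h => (verdict_eq_or w).resolve_left h⟩

/-! ### Injectivity of the stack coding

Twins of `SpaceTMSAT.encStack_injective` / `SpaceTMSAT.encStacks_injective` of `SpaceTMSATHard.lean`
(and of the private `encList_injective` there), which is not imported: it would pull the whole
space-bounded orbit-decider stack (`SpaceTMSAT`, `SpaceOracles`, `OrbitDeciders`) into this
time-bounded file for three short lemmas. -/

/-- `encList` is injective (twin of the private `SpaceTMSAT.encList_injective`). [folklore] -/
theorem encList_injective : Function.Injective encList
  | [], [], _ => rfl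
  | [], a :: l, h => by
    have := congrArg List.length h
    simp only [encList_nil, List.length_nil, encList_cons, length_boolPair] at this
    omega
  | a :: l, [], h => by
    have := congrArg List.length h
    simp only [encList_nil, List.length_nil, encList_cons, length_boolPair] at this
    omega
  | a :: l, b :: l', h => by
    have h' := congrArg boolUnpair h
    rw [encList_cons, encList_cons, boolUnpair_boolPair, boolUnpair_boolPair, Prod.mk.injEq] at h'
    rw [h'.1, encList_injective h'.2]

/-- `encStack` is injective (twin of `SpaceTMSAT.encStack_injective`, not importable cheaply). [folklore] -/
theorem encStack_injective : Function.Injective encStack := fun _ _ h =>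
  (List.map_injective_iff.2 (Function.LeftInverse.injective decode_encodeNat)) (encList_injective h)

/-- `encStacks` is injective (twin of `SpaceTMSAT.encStacks_injective`, not importable cheaply). [folklore] -/
theorem encStacks_injective : Function.Injective encStacks := fun _ _ h =>
  (List.map_injective_iff.2 encStack_injective) (encList_injective h)

/-! ### The code of a machine and the honest orbit -/

section Machine

variable (M : TM2ComputableAux Bool Bool)

/-- The input recoding of `M` (`FlatProg.exists_inputPerm`). [folklore] -/
def π : Equiv.Perm (Fin ((ucode M).N + 1)) := Classical.choose (exists_inputPerm M)

/-- Under `π M` the coded input word of `x` is `x`, `false ↦ 0`, `true ↦ 1`. [folklore] -/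
theorem π_spec (x : List Bool) : ((inCode M x).map (π M)).map Fin.val = x.map code01 :=
  Classical.choose_spec (exists_inputPerm M) x

/-- The simulated standard machine of `M`: guarded, standard, input-recoded. [cite: AroraBarakCC2009, §1.4.1] -/
abbrev cM : SCode := pcode M (π M)

/-- Its flat program. [cite: AroraBarakCC2009, §1.4] -/
abbrev PM : Prog := compile (cM M)

/-- The coded empty stacks before the input stack. [folklore] -/
def preS : List Bool := nilStacks (ucode M).k₀

/-- The separator and the coded empty stacks after the input stack. [folklore] -/
def sufS : List Bool := [false, true] ++ nilStacks ((ucode M).nK - (ucode M).k₀ - 1)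

/-- The target: the stacks field of the flat halting configuration with output `[true]`. [folklore] -/
def tgtS : List Bool := encStacks (phaltCfg M (π M) [true]).2

/-- **The code of `M`** for the universal machine:
`⟨encProg P, ⟨bin pc₀, ⟨prefix, ⟨suffix, target⟩⟩⟩⟩`. [cite: AroraBarakCC2009, §1.4 (machines as strings)] -/
def code : List Bool :=
  boolPair (encProg (PM M)) (boolPair (bin (FlatProg.entry (cM M) (cM M).main (cM M).init))
    (boolPair (preS M) (boolPair (sufS M) (tgtS M))))

/-- The instance `⟨code M, ⟨w, u⟩⟩`. [folklore] -/
def inst (w u : List Bool) : List Bool := boolPair (code M) (boolPair w u)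

/-- **The overhead polynomial** `haltAddr · X`: one step of `M` costs at most `haltAddr` flat
steps. [cite: AroraBarakCC2009, Thm. 1.9 (relaxed: C · T)] -/
def pM : Polynomial ℕ := Polynomial.C (haltAddr (cM M)) * X

/-- The flat initial configuration has `nK` stacks. [folklore] -/
theorem length_pinitCfg_snd (w : List Bool) : (pinitCfg M (π M) w).2.length = (cM M).nK := by
  rw [pinitCfg, trCfg_snd, length_encStk]

/-- **The initial code of an instance of `M` is the code of the flat initial configuration.**
[cite: AroraBarakCC2009, §1.4.1] -/
theorem ι_inst (w u : List Bool) : ι (inst M w u) = enc (PM M) (pinitCfg M (π M) w) := by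
  rw [inst, code, ι_apply, pinitCfg_eq, π_spec]
  show _ = boolPair _ (boolPair _ (encStacks _))
  rw [encStacks_replicate_set (ucode M).k₀.isLt, dbl_encStack_map_code01, preS, sufS,
    List.append_assoc]

/-- The instance is long compared with the program: `3 |encProg P| ≤ |inst|`. [folklore] -/
theorem length_prog_le (w u : List Bool) : 3 * (encProg (PM M)).length ≤ (inst M w u).length := by
  simp only [inst, code, length_boolPair]
  omega

/-- **One honest round is one flat step**: on `⟨inst, enc P cfg⟩` with `cfg` having `nK` stacks
the guard holds and the universal step is correct. [cite: AroraBarakCC2009, Thm. 1.9] -/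
theorem F_inst_enc (w u : List Bool) (cfg : Cfg) (hlen : cfg.2.length = (cM M).nK) :
    F (boolPair (inst M w u) (enc (PM M) cfg)) = boolPair (inst M w u) (enc (PM M) (step (PM M) cfg)) := by
  rw [F_apply, fstF_boolPair, G_apply, sndF_boolPair]
  have hstep : ustepFn (enc (PM M) cfg) = enc (PM M) (step (PM M) cfg) :=
    ustepFn_enc _ _ fun i hi => by rw [hlen]; exact wf_of_getElem?_compile _ hi
  have h1 := length_enc_step_le (PM M) cfg
  have h2 := length_prog_le M w u
  rw [hstep, if_pos (by rw [length_boolPair]; omega)]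

/-- **The honest orbit is the flat run.** [cite: AroraBarakCC2009, Thm. 1.9 and §1.4.1] -/
theorem iterate_F_inst (w u : List Bool) (n : ℕ) :
    F^[n] (boolPair (inst M w u) (enc (PM M) (pinitCfg M (π M) w))) =
      boolPair (inst M w u) (enc (PM M) ((step (PM M))^[n] (pinitCfg M (π M) w))) := by
  induction n with
  | zero => rfl
  | succ n ih =>
    rw [Function.iterate_succ_apply', ih,
      F_inst_enc M w u _ (length_snd_iterate_step _ n _ (length_pinitCfg_snd M w)),
      Function.iterate_succ_apply']

/-- The orbit of an instance of `M`. [cite: AroraBarakCC2009, Thm. 1.9 and §1.4.1] -/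
theorem orbit_inst (w u : List Bool) :
    orbit (inst M w u) = boolPair (inst M w u)
      (enc (PM M) ((step (PM M))^[(inst M w u).length] (pinitCfg M (π M) w))) := by
  rw [orbit_apply, ι_inst, iterate_F_inst]

/-- **The verdict on an instance of `M`**: the flat configuration after `|inst|` steps is halted
and its stacks field is the target. [cite: AroraBarakCC2009, §1.4.1] -/
theorem verdict_inst (w u : List Bool) :
    verdict (inst M w u) =
      [decide (insF (enc (PM M) ((step (PM M))^[(inst M w u).length] (pinitCfg M (π M) w))) = []) &&
        decide (ssF (enc (PM M) ((step (PM M))^[(inst M w u).length] (pinitCfg M (π M) w))) = tgtS M)] := by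
  have ht : tgtI (inst M w u) = tgtS M := by rw [inst, code, tgtI_apply]
  rw [verdict, Function.comp_apply, orbit_inst, checkF_boolPair, ht]

/-- The stacks field of a code. [folklore] -/
theorem ssF_enc (P : Prog) (cfg : Cfg) : ssF (enc P cfg) = encStacks cfg.2 :=
  (fields_enc P cfg.1 cfg.2).2.2

/-- **Completeness**: if `M` outputs `[true]` on `w` within `t` steps and `haltAddr · t ≤ N`,
the instance `⟨code M, ⟨w, 1ᴺ⟩⟩` is accepted. [cite: AroraBarakCC2009, Thm. 1.9 and §1.4.1] -/
theorem complete {w : List Bool} {t N : ℕ} (h : M.OutputsWithin w [true] t) (hN : (pM M).eval t ≤ N) :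
    inst M w (List.replicate N true) ∈ U := by
  have hR : t * haltAddr (cM M) ≤ (inst M w (List.replicate N true)).length := by
    have e : (pM M).eval t = haltAddr (cM M) * t := by simp [pM]
    have hl : N ≤ (inst M w (List.replicate N true)).length := by
      simp only [inst, length_boolPair, List.length_replicate]
      omega
    rw [Nat.mul_comm]
    omega
  have hrun : (step (PM M))^[(inst M w (List.replicate N true)).length] (pinitCfg M (π M) w) =
      phaltCfg M (π M) [true] := pflat_complete M (π M) h hR
  show verdict _ = [true]
  rw [verdict_inst, hrun, (insF_enc_eq_nil_iff _ _).2 (by rw [length_compile, phaltCfg_fst]), ssF_enc]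
  simp [tgtS]

/-- **Soundness**: if the instance `⟨code M, ⟨w, u⟩⟩` is accepted then `M` outputs `[true]` on
`w` (within `|inst|` steps). [cite: AroraBarakCC2009, Thm. 1.9 and §1.4.1] -/
theorem sound {w u : List Bool} (h : inst M w u ∈ U) : ∃ t, M.OutputsWithin w [true] t := by
  have hv : verdict (inst M w u) = [true] := h
  rw [verdict_inst] at hv
  simp only [List.cons.injEq, Bool.and_eq_true, decide_eq_true_eq, and_true] at hv
  obtain ⟨hhalt, hstk⟩ := hv
  refine ⟨(inst M w u).length, pflat_sound M (π M) (Prod.ext ?_ ?_)⟩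
  · -- the flat configuration reached is halted, so its program counter is the halt address
    have hpc : haltAddr (cM M) ≤ ((step (compile (cM M)))^[(inst M w u).length] (trCfg (cM M)
        (initList (cM M).tm ((inCode M w).map (π M))))).1 := by
      rw [← length_compile]
      exact (insF_enc_eq_nil_iff _ _).1 hhalt
    obtain ⟨n, -, d, -, hd, hfin⟩ := exists_halt_of_iterate (cM M) _ _ hpc
    rw [phaltCfg_fst]
    show ((step (compile (cM M)))^[(inst M w u).length] (trCfg (cM M)
      (initList (cM M).tm ((inCode M w).map (π M))))).1 = _
    rw [hfin]
    exact trCfg_fst_of_none _ ((step_eq_none_iff _ d).1 hd)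
  · -- ... and its stacks are the target stacks
    rw [ssF_enc, tgtS] at hstk
    exact encStacks_injective hstk

end Machine

end ClockedUA

/-- **Discharge of `clockedUniversalAcceptance`** (Arora–Barak 2009, Thm. 1.9 with §1.4.1): the
bounded acceptance language `ClockedUA.U` of the clocked universal machine is in `P`, and for
every machine `M` the code `ClockedUA.code M` and the overhead polynomial `haltAddr · X` satisfy
completeness and soundness. [cite: AroraBarakCC2009, Thm. 1.9 and §1.4.1] -/
theorem clockedUniversalAcceptance_holds : clockedUniversalAcceptance :=
  ⟨ClockedUA.U, ClockedUA.U_mem_P, fun M => ⟨ClockedUA.code M, ClockedUA.pM M,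
    fun _ _ _ h hN => ClockedUA.complete M h hN, fun _ _ h => ClockedUA.sound M h⟩⟩

end Literature.Computability.Complexity
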